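import Mathlib
import Summits.MatrixMultiplication.MatrixMultiplication.Theses.GLnSeparatingDesigns
import Literature.NumberTheory.DiophantineGeometry.GLPolynomialRepSemisimpleProofs
import Summits.MatrixMultiplication.MatrixMultiplication.Theorems.GLnSeparatingDesignsSeparationDegreeCostBlockBound

/-!
# Split designs, step (ii-a): a nonsingular Gram matrix forces `|Y| ≤ dim span{R_g p₀}`

Stub `stub_split_card_le_finrank_span` of line `Ideate5Sketch` (crux `BorderHalfDimensionDesigns`,
item stmt-MatrixMultiplication-18360, route `GLnSeparatingDesigns`), E2 = the split-design barrier.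

If the Gram matrix `(p₀(y⁻¹ y'))_{y, y' ∈ Y}` of one middle test `p₀ ∈ ℂ[Mat_n]` on a finite set
`Y ⊆ GL_n(ℂ)` is nonsingular, then `|Y| ≤ dim N`, where `N := span{R_g p₀ : g ∈ GL_n(ℂ)}` is the
cyclic module of `p₀` under right translation (`R_g = matTransl`, `(R_g p)(M) = p(M g)`).

Proof.  `N` lies in `ℂ[Mat_n]_{≤ deg p₀}` (`totalDegree_matTransl_le`), so it is finite-dimensional.
The evaluation map `E : P ↦ (P(y⁻¹))_{y ∈ Y}` is linear, and by `eval_matTransl` it sends the right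
translate `R_{y'} p₀` to the column `y'` of the Gram matrix: `(R_{y'} p₀)(y⁻¹) = p₀(y⁻¹ y')`.  The
columns of a nonsingular matrix are linearly independent, hence so are the `|Y|` translates
`R_{y'} p₀ ∈ N` (`LinearIndependent.of_comp`), and `|Y| ≤ dim N`.
-/

set_option linter.dupNamespace false

open scoped BigOperators Matrix

namespace Summit.MatrixMultiplication.MatrixMultiplication.Theorems.BorderHalfDimensionDesigns

open Literature.NumberTheory.DiophantineGeometry

/-- **Right translates evaluate to Gram entries.** `(R_{y'} P)(y⁻¹) = P(y⁻¹ y')` for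
`y, y' ∈ GL_σ(k)`: the special case `x = y⁻¹`, `g = y'` of `eval_matTransl`. -/
theorem splitGram_eval_inv_matTransl {σ k : Type*} [Fintype σ] [DecidableEq σ] [CommRing k]
    (y y' : Matrix.GeneralLinearGroup σ k) (P : MvPolynomial (σ × σ) k) :
    MvPolynomial.eval (fun ij : σ × σ => ((y⁻¹ : Matrix.GeneralLinearGroup σ k) : Matrix σ σ k) ij.1 ij.2)
        (matTransl σ k (y' : Matrix σ σ k) P) =
      MvPolynomial.eval (fun ij : σ × σ =>
        ((y⁻¹ * y' : Matrix.GeneralLinearGroup σ k) : Matrix σ σ k) ij.1 ij.2) P := by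
  rw [eval_matTransl]
  simp only [Units.val_mul, Matrix.mul_apply]

/-- STUB (ii-a) of E2 — **Gram columns are right translates.**  If the Gram matrix `(p₀(y⁻¹ y'))_{y,y' ∈ Y}`
is nonsingular then `|Y| ≤ dim span{R_g p₀ : g ∈ GL_n(ℂ)}` (`R_g = matTransl`, `(R_g p)(M) = p(M g)`; the span is
finite-dimensional, inside `ℂ[Mat_n]_{≤ deg p₀}`). -/
theorem stub_split_card_le_finrank_span {n : ℕ} (Y : Finset (Matrix.GeneralLinearGroup (Fin n) ℂ))
    (p₀ : MvPolynomial (Fin n × Fin n) ℂ)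
    (hGram : (Matrix.of fun y y' : ↥Y => MvPolynomial.eval (fun ij : Fin n × Fin n =>
      ((y.1⁻¹ * y'.1 : Matrix.GeneralLinearGroup (Fin n) ℂ) : Matrix (Fin n) (Fin n) ℂ) ij.1 ij.2) p₀).det ≠ 0) :
    Y.card ≤ Module.finrank ℂ (Submodule.span ℂ (Set.range fun g : Matrix.GeneralLinearGroup (Fin n) ℂ =>
      matTransl (Fin n) ℂ (g : Matrix (Fin n) (Fin n) ℂ) p₀)) := by
  classical
  set N : Submodule ℂ (MvPolynomial (Fin n × Fin n) ℂ) := Submodule.span ℂ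
    (Set.range fun g : Matrix.GeneralLinearGroup (Fin n) ℂ =>
      matTransl (Fin n) ℂ (g : Matrix (Fin n) (Fin n) ℂ) p₀) with hN
  -- (1) `N ⊆ ℂ[Mat_n]_{≤ deg p₀}` is finite-dimensional
  haveI : FiniteDimensional ℂ N := by
    refine Submodule.finiteDimensional_of_le
      (S₂ := MvPolynomial.restrictTotalDegree (Fin n × Fin n) ℂ p₀.totalDegree) ?_
    refine Submodule.span_le.2 ?_
    rintro _ ⟨g, rfl⟩
    rw [SetLike.mem_coe, MvPolynomial.mem_restrictTotalDegree]
    exact totalDegree_matTransl_le _ _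
  -- (2) the evaluation map at the points `y⁻¹`, `y ∈ Y`
  let E : MvPolynomial (Fin n × Fin n) ℂ →ₗ[ℂ] (↥Y → ℂ) :=
    { toFun := fun P y => MvPolynomial.eval (fun ij : Fin n × Fin n =>
        ((y.1⁻¹ : Matrix.GeneralLinearGroup (Fin n) ℂ) : Matrix (Fin n) (Fin n) ℂ) ij.1 ij.2) P
      map_add' := fun P Q => funext fun y => by simp only [map_add, Pi.add_apply]
      map_smul' := fun c P => funext fun y => by
        simp only [MvPolynomial.smul_eval, RingHom.id_apply, Pi.smul_apply, smul_eq_mul] }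
  have hE : ∀ (P : MvPolynomial (Fin n × Fin n) ℂ) (y : ↥Y), E P y =
      MvPolynomial.eval (fun ij : Fin n × Fin n =>
        ((y.1⁻¹ : Matrix.GeneralLinearGroup (Fin n) ℂ) : Matrix (Fin n) (Fin n) ℂ) ij.1 ij.2) P :=
    fun _ _ => rfl
  -- the translates `R_{y'} p₀ ∈ N`
  let v : ↥Y → N := fun y' =>
    ⟨matTransl (Fin n) ℂ (y'.1 : Matrix (Fin n) (Fin n) ℂ) p₀, Submodule.subset_span ⟨y'.1, rfl⟩⟩
  -- (3) `E (R_{y'} p₀)` is the column `y'` of the Gram matrix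
  have hcol : (Matrix.of fun y y' : ↥Y => MvPolynomial.eval (fun ij : Fin n × Fin n =>
      ((y.1⁻¹ * y'.1 : Matrix.GeneralLinearGroup (Fin n) ℂ) : Matrix (Fin n) (Fin n) ℂ) ij.1 ij.2) p₀).col =
      (E ∘ₗ N.subtype) ∘ v := by
    funext y' y
    rw [Matrix.col_apply, Matrix.of_apply, Function.comp_apply, LinearMap.comp_apply,
      Submodule.subtype_apply, hE, splitGram_eval_inv_matTransl]
  -- (4) nonsingular ⟹ independent columns ⟹ independent translates in `N`
  have hli : LinearIndependent ℂ v := by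
    refine LinearIndependent.of_comp (E ∘ₗ N.subtype) ?_
    rw [← hcol]
    exact Matrix.linearIndependent_cols_of_det_ne_zero hGram
  have h := hli.fintype_card_le_finrank
  rwa [Fintype.card_coe] at h

end Summit.MatrixMultiplication.MatrixMultiplication.Theorems.BorderHalfDimensionDesigns
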